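/-
Origin: expansion seat `planner-pub-hodgecm-pv09-g6-0`, handover #3 2026-08-18T11:45:32Z (`HOME/pub-hodgecm-pv09-g6/lean/Pv09g6/GenuineTensorInput.lean`, md5 d7518b51, 185 lines);
landed by the gen-8 packager in gate run 29 as `HodgeCM/PerL34/GenuineTensorInput.lean` (import ^import Pv09g6\.GenuineTensorModel[ \t]*$→import HodgeCM.PerL34.GenuineTensorModel ×1).
-/
/-
Copyright: HodgeCM publication cell (pub-hodgecm), seam S3 (𝓕-side / genuine idelic torus end; the
representation-side INPUT of `GenuineThetaInput` for the NATURAL data).  Prover seat pub-hodgecm-pv09-g6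
(DAG-node prover #09, generation 6), file #3 (HANDOVER #3); intended final place
`HodgeCM/PerL34/GenuineTensorInput.lean`.  WIP import: `Pv09g6.GenuineTensorModel` ↦
`HodgeCM.PerL34.GenuineTensorModel` (this seat, HANDOVER #2).  Complete proofs, no new axioms, nothing cited.
Released under the package licence.
-/
import Summits.HodgeConjecture.HodgeCM.PerL34.GenuineTensorModel_2
import Summits.HodgeConjecture.HodgeCM.PerL34.GenuineSchrodingerContinuity

/-!
# The genuine torus: `GenuineThetaInput` inhabited for the NATURAL data (radii exist)

`HodgeCM/PerL34/GenuineTensorModel.lean` (#2) inhabits `PureTensor.GenuineThetaInput L S (⊗′H) (⊗′ρ) φ• χ` given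
balls `B(x₀_i, r_i)` at the split places of `S` on which `ν_i` and `χ_i` are trivial (the END's `hr, hr0, hνS,
hχS`).  Here those four hypotheses are DISCHARGED by choice of the radii (PerL v5 ll. 617–621, "`N` large"): for
every CM field `L`, finite `S`, global unitary character `χ` with the END's level / continuity hypotheses
`hχT'`, `hlocχ`, every family `ν_i` with the END's `hν` and `Continuous (ν i)` at the split places, and every
family of centres `x₀_i ≠ 0` at the split places of `S`, there are radii `r_i ∈ (0, |x₀_i|)` such that
`GenuineThetaInput L S (⊗′H) (⊗′ρ) (φ•(x₀, r)) χ` is inhabited (`Genuine.thetaInputOfData`,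
`Genuine.exists_thetaInput`) — together with `(hφ)/(hK)/(hM)/(hloc)` from #2.  The radii come from pv13-g4's
`GenuineSchrodingerInput.exists_radius_forall_U1_eq_one_of_continuous` (run 28; = `KernelRadius` at the
extension by `1`) applied to `ν_i` and to `χ_i ∘ baseTriv_i⁻¹`; at a split place `i ∉ T'` no continuity of
`χ_i` is needed (`U₁ ⊆ {|y| = 1} = baseTriv_i(B_i)` and `χ` has level `K_{T'}`).

Honest limits: as in #2 (torus-side model; `hiso` by construction; nothing cited).
-/

set_option autoImplicit false

noncomputable section

open MeasureTheory MeasureTheory.Measure Set Metric Function Complex ComplexConjugate Topology Filter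
open scoped RestrictedProduct InnerProductSpace NNReal ENNReal

namespace HodgeCM.PerL34.RestrictedTensor.Genuine

open NumberField IsDedekindDomain HodgeCM.PerL34.IdelePlaces HodgeCM.PerL34.NoSmallSubgroups
open HodgeCM.PerL34.IdelicTorusModel HodgeCM.PerL34.IdelicTorusModel.Genuine HodgeCM.PerL34.PureTensor
open HodgeCM.PerL34.LocalFactors HodgeCM.PerL34.LocalFactors.DilationModel

attribute [local instance] LocalFactors.DilationModel.Adic.nontriviallyNormedField
  LocalFactors.DilationModel.Adic.properSpace

variable (L : Type) [Field L] [NumberField L] [IsCMField L] [DecidableEq (Place (maximalRealSubfield L))]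
  (χ : Model L →* Circle)
  (ν : ∀ i : Place (maximalRealSubfield L), ((basePlaceOf L i).adicCompletion (maximalRealSubfield L))ˣ →* Circle)

/-! ## §1  The local character `χ_i` on `(L⁺_v)ˣ` through the base chart -/

/-- `χ_i ∘ baseTriv_i⁻¹ : (L⁺_{v(i)})ˣ →* 𝕊¹` at a split index. -/
def chiBase (i : Place (maximalRealSubfield L)) (hs : IsSplitPlace L i) :
    ((basePlaceOf L i).adicCompletion (maximalRealSubfield L))ˣ →* Circle :=
  (locChar L χ i).comp
    ((baseTriv L i hs).symm :
      ((basePlaceOf L i).adicCompletion (maximalRealSubfield L))ˣ →* locTorus (maximalRealSubfield L) L i)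

/-- (Ported verbatim from the HodgeCMPerL package; no docstring in the source.) -/
theorem chiBase_baseTriv (i : Place (maximalRealSubfield L)) (hs : IsSplitPlace L i)
    (g : locTorus (maximalRealSubfield L) L i) :
    chiBase L χ i hs (baseTriv L i hs g) = χ (RestrictedProduct.mulSingle (genLevel L) i g) := by
  rw [chiBase, MonoidHom.comp_apply, MonoidHom.coe_coe, ContinuousMulEquiv.symm_apply_apply, locChar_apply]

/-- (Ported verbatim from the HodgeCMPerL package; no docstring in the source.) -/
theorem continuous_chiBase (i : Place (maximalRealSubfield L)) (hs : IsSplitPlace L i)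
    (h : Continuous fun g : locTorus (maximalRealSubfield L) L i =>
      χ (RestrictedProduct.mulSingle (genLevel L) i g)) :
    Continuous (chiBase L χ i hs) :=
  h.comp (baseTriv L i hs).symm.continuous

/-! ## §2  The radius at one split place of `S` -/

variable {χ ν}

/-- **"N large"** at a split place: a radius `r ∈ (0, |x₀|)` with `ν_i = 1` on `U₁(x₀, r)` and `χ_i = 1` on
`baseTriv_i⁻¹ U₁(x₀, r)` — by continuity of `ν_i` and (for `i ∈ T'`) of `χ_i`; for `i ∉ T'` by the level. -/
theorem exists_radius {T' : Finset (Place (maximalRealSubfield L))}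
    (hχT' : RestrictedProduct.boxSubgroup (genLevel L) T' ≤ χ.ker)
    (hlocχ : ∀ i ∈ T', Continuous fun g : locTorus (maximalRealSubfield L) L i =>
      χ (RestrictedProduct.mulSingle (genLevel L) i g))
    (hνc : ∀ i, IsSplitPlace L i → Continuous (ν i))
    (i : Place (maximalRealSubfield L)) (hs : IsSplitPlace L i)
    {x : Fin 3 → (basePlaceOf L i).adicCompletion (maximalRealSubfield L)} (hx : x ≠ 0) :
    ∃ r : ℝ, 0 < r ∧ r < ‖x‖ ∧
      (∀ y : ((basePlaceOf L i).adicCompletion (maximalRealSubfield L))ˣ,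
        (y : (basePlaceOf L i).adicCompletion (maximalRealSubfield L)) ∈ U1 x r → ν i y = 1) ∧
      (∀ g : locTorus (maximalRealSubfield L) L i,
        ((baseTriv L i hs g : ((basePlaceOf L i).adicCompletion (maximalRealSubfield L))ˣ) :
            (basePlaceOf L i).adicCompletion (maximalRealSubfield L)) ∈ U1 x r →
          χ (RestrictedProduct.mulSingle (genLevel L) i g) = 1) := by
  obtain ⟨r₁, h1pos, h1lt, h1⟩ :=
    GenuineSchrodingerInput.exists_radius_forall_U1_eq_one_of_continuous (n := 3) (ν i) (hνc i hs) hx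
  by_cases hiT : i ∈ T'
  · obtain ⟨r₂, h2pos, -, h2⟩ :=
      GenuineSchrodingerInput.exists_radius_forall_U1_eq_one_of_continuous (n := 3) (chiBase L χ i hs)
        (continuous_chiBase L χ i hs (hlocχ i hiT)) hx
    refine ⟨min r₁ r₂, lt_min h1pos h2pos, (min_le_left _ _).trans_lt h1lt,
      fun y hy => h1 _ (lt_min h1pos h2pos) (min_le_left _ _) y hy, fun g hg => ?_⟩
    rw [← chiBase_baseTriv L χ i hs g]
    exact h2 _ (lt_min h1pos h2pos) (min_le_right _ _) _ hg
  · exact ⟨r₁, h1pos, h1lt, fun y hy => h1 _ h1pos le_rfl y hy, fun g hg =>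
      chi_mulSingle_eq_one L hχT' hiT
        ((mem_genLevel_iff_norm_baseTriv_eq_one L i hs g).2 (norm_eq_one_of_mem_U1 h1lt hg))⟩

/-! ## §3  The radii, the inhabitant for the natural data -/

section data

variable (S : Finset (Place (maximalRealSubfield L))) {T' : Finset (Place (maximalRealSubfield L))}
  (hν : ∀ i, i ∉ S → IsSplitPlace L i → ∀ u : ((basePlaceOf L i).adicCompletion (maximalRealSubfield L))ˣ,
    ‖(u : (basePlaceOf L i).adicCompletion (maximalRealSubfield L))‖ = 1 → ν i u = 1)
  (hνc : ∀ i, IsSplitPlace L i → Continuous (ν i))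
  (hχT' : RestrictedProduct.boxSubgroup (genLevel L) T' ≤ χ.ker)
  (hlocχ : ∀ i ∈ T', Continuous fun g : locTorus (maximalRealSubfield L) L i =>
    χ (RestrictedProduct.mulSingle (genLevel L) i g))
  (x₀ : ∀ i : Place (maximalRealSubfield L), Fin 3 → (basePlaceOf L i).adicCompletion (maximalRealSubfield L))
  (hx₀ : ∀ i ∈ S, IsSplitPlace L i → x₀ i ≠ 0)

open scoped Classical in
/-- **the radii** `r_i`: the radius of §2 at the split places of `S`, `1` elsewhere (never used there). -/
def radius (i : Place (maximalRealSubfield L)) : ℝ :=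
  if h : i ∈ S ∧ IsSplitPlace L i then
    Classical.choose (exists_radius L hχT' hlocχ hνc i h.2 (hx₀ i h.1 h.2))
  else 1

/-- (Ported verbatim from the HodgeCMPerL package; no docstring in the source.) -/
theorem radius_spec (i : Place (maximalRealSubfield L)) (hi : i ∈ S) (hs : IsSplitPlace L i) :
    0 < radius L S hνc hχT' hlocχ x₀ hx₀ i ∧ radius L S hνc hχT' hlocχ x₀ hx₀ i < ‖x₀ i‖ ∧
      (∀ y : ((basePlaceOf L i).adicCompletion (maximalRealSubfield L))ˣ,
        (y : (basePlaceOf L i).adicCompletion (maximalRealSubfield L)) ∈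
            U1 (x₀ i) (radius L S hνc hχT' hlocχ x₀ hx₀ i) → ν i y = 1) ∧
      (∀ g : locTorus (maximalRealSubfield L) L i,
        ((baseTriv L i hs g : ((basePlaceOf L i).adicCompletion (maximalRealSubfield L))ˣ) :
            (basePlaceOf L i).adicCompletion (maximalRealSubfield L)) ∈
              U1 (x₀ i) (radius L S hνc hχT' hlocχ x₀ hx₀ i) →
          χ (RestrictedProduct.mulSingle (genLevel L) i g) = 1) := by
  classical
  have h : i ∈ S ∧ IsSplitPlace L i := ⟨hi, hs⟩
  rw [radius, dif_pos h]
  exact Classical.choose_spec (exists_radius L hχT' hlocχ hνc i hs (hx₀ i hi hs))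

variable
  [∀ v : HeightOneSpectrum (𝓞 (maximalRealSubfield L)), MeasurableSpace (v.adicCompletion (maximalRealSubfield L))]
  [∀ v : HeightOneSpectrum (𝓞 (maximalRealSubfield L)), BorelSpace (v.adicCompletion (maximalRealSubfield L))]

/-- **THE INHABITANT FOR THE NATURAL DATA**: `GenuineThetaInput L S (⊗′H) (⊗′ρ) (φ•(x₀, r)) χ` with the radii
`r = radius …` chosen by continuity. -/
def thetaInputOfData :
    GenuineThetaInput L S (Space (unitFam L)) (rep (admissible L hν hχT'))
      (phi L S x₀ (radius L S hνc hχT' hlocχ x₀ hx₀)) χ :=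
  thetaInput L S x₀ hν hχT' (fun i hi hs => (radius_spec L S hνc hχT' hlocχ x₀ hx₀ i hi hs).2.1)
    (fun i hi hs => (radius_spec L S hνc hχT' hlocχ x₀ hx₀ i hi hs).1)
    (fun i hi hs => (radius_spec L S hνc hχT' hlocχ x₀ hx₀ i hi hs).2.2.1)
    (fun i hi hs => (radius_spec L S hνc hχT' hlocχ x₀ hx₀ i hi hs).2.2.2)

include hνc hlocχ hx₀ in
/-- **For the natural data, radii exist making every `(ω, φ)`-hypothesis of the S3 END hold and the input
structure inhabited** — for every CM field `L` and every finite `S`. -/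
theorem exists_thetaInput :
    ∃ r : Place (maximalRealSubfield L) → ℝ,
      (∀ i ∈ S, IsSplitPlace L i → 0 < r i ∧ r i < ‖x₀ i‖) ∧
      ‖phi L S x₀ r‖ = 1 ∧
      (∀ k ∈ RestrictedProduct.boxSubgroup (genLevel L) (S ∪ T'),
        rep (admissible L hν hχT') k (phi L S x₀ r) = phi L S x₀ r) ∧
      (∀ (S₁ : Finset (Place (maximalRealSubfield L)))
        (y : (i : ↥S₁) → locTorus (maximalRealSubfield L) L i),
        inner ℂ (phi L S x₀ r) (rep (admissible L hν hχT') (PureTensor.extendOne (genLevel L) S₁ y) (phi L S x₀ r)) =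
          ∏ i : ↥S₁, PureTensor.localCoeff (genLevel L) (rep (admissible L hν hχT')) (phi L S x₀ r) i (y i)) ∧
      (∀ (i : Place (maximalRealSubfield L)) (v : Space (unitFam L)),
        Continuous fun g : locTorus (maximalRealSubfield L) L i =>
          rep (admissible L hν hχT') (RestrictedProduct.mulSingle (genLevel L) i g) v) ∧
      Nonempty (GenuineThetaInput L S (Space (unitFam L)) (rep (admissible L hν hχT')) (phi L S x₀ r) χ) :=
  ⟨radius L S hνc hχT' hlocχ x₀ hx₀,
    fun i hi hs => ⟨(radius_spec L S hνc hχT' hlocχ x₀ hx₀ i hi hs).1,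
      (radius_spec L S hνc hχT' hlocχ x₀ hx₀ i hi hs).2.1⟩,
    norm_phi L S x₀ fun i hi hs => (radius_spec L S hνc hχT' hlocχ x₀ hx₀ i hi hs).1,
    fun _ hk => rep_phi_eq_self L S x₀ _ hν hχT' hk,
    fun S₁ y => inner_phi_rep_extendOne L S x₀ hν hχT'
      (fun i hi hs => (radius_spec L S hνc hχT' hlocχ x₀ hx₀ i hi hs).1) S₁ y,
    fun i v => continuous_rep_mulSingle_apply L S hν hχT' hνc hlocχ i v,
    ⟨thetaInputOfData L S hν hνc hχT' hlocχ x₀ hx₀⟩⟩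

end data

end HodgeCM.PerL34.RestrictedTensor.Genuine

end
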